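import Summits.ABC.ABC.Theses.RibetTakahashiSplit
import Summits.ABC.ABC.Theorems.AbcValuationProduct
import Literature.NumberTheory.DiophantineGeometry.AbcValuationProduct
import Literature.NumberTheory.DiophantineGeometry.AbcWave0QualityFormProofs
import Literature.NumberTheory.Sieve.DivisorBound

/-!
# `AbcValuationProduct`: what the milestone is equivalent to, implies, and follows from

The milestone `AbcValuationProduct` (`Summit.ABC.ABC.Theorems.AbcValuationProduct`, the open obligation
re-homed in `Theorems/AbcValuationProduct.lean`; formerly the route item
`Summit.ABC.ABC.Theses.RibetTakahashiSplit.AbcValuationProduct`, stmt-ABC-1567) is Pasten's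
product-of-valuations theorem for abc triples with the exponent `8/3 + ε` replaced by `ε`:
`∀ ε > 0 ∃ K, ∀ abc triples, ∏_{p ∣ abc} ν_p(abc) ≤ K · rad(abc)^ε`. It is an open milestone
(it implies `log c ≪_ε rad(abc)^ε · log rad(abc)`, below every Baker-shape bound), so this file
records its exact logical position instead of a proof:

* `AbcValuationProduct_iff` — the decl in the vocabulary of
  `Literature.NumberTheory.DiophantineGeometry.exponentProduct`;
* `AbcValuationProduct_iff_card_divisors` — the divisor form `d(abc) ≪_ε rad(abc)^ε`
  ("`d(abc) ≤ rad^{o(1)}`"), via `∏ ν_p ≤ d ≤ 2^ω ∏ ν_p` and `2^{ω(abc)} ≪_δ rad(abc)^δ`;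
* `pasten2024_thm_2_5_of_abcValuationProduct` — it is STRONGER THAN PRINT: it implies the named
  fact `pasten2024_thm_2_5` (exponent `8/3 + ε`), because `rad(abc) ≥ 2`;
* `abcValuationProduct_of_abc` — it FOLLOWS FROM THE SUMMIT `ABC`: `∏ ν_p(abc) ≤ d(abc) ≤
  C_δ (abc)^δ ≤ C_δ c^{3δ}` (divisor bound, Hardy–Wright Thm 315, proved in the tree as
  `Literature.NumberTheory.Sieve.exists_card_divisors_le_mul_rpow`) and `c < C · rad²` from abc at
  `ε = 1`; so no refutation of the milestone exists short of `¬ ABC`.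

* `subexp_of_abcValuationProduct` / `subexpOfValuationProduct` — what the milestone buys:
  `log c ≤ κ_ε rad(abc)^ε` for every `ε` (the route's glue C `SubexpOfValuationProduct`, via
  `log c ≤ (∏ ν_p(abc)) · log rad(abc)` and `log x ≤ (2/ε) x^{ε/2}`).

Inside the route the milestone is the composite of the two cruxes `ManyPrimeValuationProduct`
(r2) and `FewPrimeValuationProduct` (r4): that implication (the glue `ValuationProductOfCurves`,
a Frey-curve translation) is proved in the sibling file
`RibetTakahashiSplitAbcValuationProductOfCurves.lean` (`abcValuationProduct_of_many_few`).
-/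

-- `Summit.<Summit>.<Problem>` is the mandated summit-side namespace (CONVENTIONS §2); for the
-- single-conjunct summit `ABC` the two coincide, so the duplicate `ABC.ABC` is deliberate.
set_option linter.dupNamespace false

namespace Summit.ABC.ABC.Theorems

open Literature.NumberTheory.DiophantineGeometry
open Summit.ABC.ABC.Theses.RibetTakahashiSplit

/-- Unfolding: `AbcValuationProduct` is `∀ ε > 0 ∃ K ∀ abc triples,
exponentProduct(abc) ≤ K · rad(abc)^ε` (`Real.rpow`). `[folklore]` -/
theorem AbcValuationProduct_iff :
    AbcValuationProduct ↔ ∀ ε : ℝ, 0 < ε → ∃ K : ℝ, ∀ a b c : ℕ, IsABCTriple a b c →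
      (exponentProduct (a * b * c) : ℝ) ≤ K * (rad a b c : ℝ) ^ ε :=
  Iff.rfl

/-- **Stronger than print.** `AbcValuationProduct` (exponent `ε`) implies Pasten's theorem
`pasten2024_thm_2_5` (exponent `8/3 + ε`), since `rad(abc) ≥ 2 ≥ 1`. `[folklore]` -/
theorem pasten2024_thm_2_5_of_abcValuationProduct (h : AbcValuationProduct) :
    pasten2024_thm_2_5 := by
  intro ε hε
  obtain ⟨K, hK⟩ := h ε hε
  refine ⟨max K 0, fun a b c habc => ?_⟩
  have hR1 : (1 : ℝ) ≤ (rad a b c : ℝ) := by exact_mod_cast (le_trans (by norm_num) habc.two_le_rad)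
  calc (exponentProduct (a * b * c) : ℝ) ≤ K * (rad a b c : ℝ) ^ ε := hK a b c habc
    _ ≤ max K 0 * (rad a b c : ℝ) ^ ε :=
        mul_le_mul_of_nonneg_right (le_max_left _ _) (by positivity)
    _ ≤ max K 0 * (rad a b c : ℝ) ^ (8 / 3 + ε : ℝ) :=
        mul_le_mul_of_nonneg_left
          (Real.rpow_le_rpow_of_exponent_le hR1 (by linarith)) (le_max_right _ _)

/-- For an abc triple, `abc ≤ c³` (as `a, b ≤ c`). `[folklore]` -/
theorem AbcValuationProduct.mul_le_pow_three {a b c : ℕ} (h : IsABCTriple a b c) :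
    a * b * c ≤ c ^ 3 := by
  obtain ⟨-, -, habc, -⟩ := h
  have ha : a ≤ c := by omega
  have hb : b ≤ c := by omega
  calc a * b * c ≤ c * c * c := by gcongr
    _ = c ^ 3 := by ring

/-- **The milestone follows from the summit.** `ABC → AbcValuationProduct`: with the divisor
bound `d(n) ≤ C_δ n^δ` (Hardy–Wright Thm 315) at `δ = ε/6` and abc at exponent `1 + 1`,
`∏ ν_p(abc) ≤ d(abc) ≤ C_δ (abc)^δ ≤ C_δ (c³)^δ ≤ C_δ (C rad²)^{3δ} = C_δ C^{3δ} rad^ε`.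
In particular the milestone cannot be refuted short of disproving the abc conjecture.
`[folklore]` -/
theorem abcValuationProduct_of_abc (habc : _root_.ABC) : AbcValuationProduct := by
  intro ε hε
  have hδ : (0 : ℝ) < ε / 6 := by positivity
  obtain ⟨D, hD1, hD⟩ := Literature.NumberTheory.Sieve.exists_card_divisors_le_mul_rpow hδ
  obtain ⟨C, hC, hABC⟩ := habc 1 one_pos
  refine ⟨D * (C ^ 3) ^ (ε / 6), fun a b c ht => ?_⟩
  have h0 : a * b * c ≠ 0 := ht.mul_ne_zero
  have hR : (0 : ℝ) < (rad a b c : ℝ) := cast_rad_pos a b c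
  set R : ℝ := (rad a b c : ℝ) with hRdef
  -- `c < C · R²`
  have hc : (c : ℝ) < C * R ^ 2 := by
    have := hABC a b c ht
    rwa [show (1 : ℝ) + 1 = 2 by norm_num, Real.rpow_two] at this
  -- `abc ≤ c³ ≤ (C R²)³ = C³ R⁶`
  have habc_le : ((a * b * c : ℕ) : ℝ) ≤ C ^ 3 * R ^ 6 := by
    have h1 : ((a * b * c : ℕ) : ℝ) ≤ (c : ℝ) ^ 3 := by
      exact_mod_cast AbcValuationProduct.mul_le_pow_three ht
    have h2 : (c : ℝ) ^ 3 ≤ (C * R ^ 2) ^ 3 := by gcongr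
    calc ((a * b * c : ℕ) : ℝ) ≤ (c : ℝ) ^ 3 := h1
      _ ≤ (C * R ^ 2) ^ 3 := h2
      _ = C ^ 3 * R ^ 6 := by ring
  -- `(abc)^δ ≤ (C³)^δ · R^ε`
  have hpow : ((a * b * c : ℕ) : ℝ) ^ (ε / 6) ≤ (C ^ 3) ^ (ε / 6) * R ^ ε := by
    calc ((a * b * c : ℕ) : ℝ) ^ (ε / 6) ≤ (C ^ 3 * R ^ 6) ^ (ε / 6) :=
          Real.rpow_le_rpow (by positivity) habc_le hδ.le
      _ = (C ^ 3) ^ (ε / 6) * (R ^ 6) ^ (ε / 6) := Real.mul_rpow (by positivity) (by positivity)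
      _ = (C ^ 3) ^ (ε / 6) * R ^ ε := by
          congr 1
          rw [← Real.rpow_natCast R 6, ← Real.rpow_mul hR.le]
          norm_num
          ring_nf
  calc (exponentProduct (a * b * c) : ℝ) ≤ ((a * b * c).divisors.card : ℝ) := by
        exact_mod_cast exponentProduct_le_card_divisors h0
    _ ≤ D * ((a * b * c : ℕ) : ℝ) ^ (ε / 6) := hD _ h0
    _ ≤ D * ((C ^ 3) ^ (ε / 6) * R ^ ε) := mul_le_mul_of_nonneg_left hpow (by linarith)
    _ = D * (C ^ 3) ^ (ε / 6) * R ^ ε := by ring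

/-- **Divisor form.** `AbcValuationProduct` is equivalent to `d(abc) ≪_ε rad(abc)^ε`
("`d(abc) ≤ rad(abc)^{o(1)}`"): `∏ ν_p ≤ d` one way, `d ≤ 2^{ω} ∏ ν_p` and
`2^{ω(abc)} ≤ C_δ rad(abc)^δ` (`exists_two_pow_card_primeFactors_le`) the other. `[folklore]` -/
theorem AbcValuationProduct_iff_card_divisors :
    AbcValuationProduct ↔ ∀ ε : ℝ, 0 < ε → ∃ K : ℝ, ∀ a b c : ℕ, IsABCTriple a b c →
      ((a * b * c).divisors.card : ℝ) ≤ K * (rad a b c : ℝ) ^ ε := by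
  constructor
  · intro h ε hε
    obtain ⟨κ, hκ⟩ := h (ε / 2) (by positivity)
    obtain ⟨C, hC, hCω⟩ := exists_two_pow_card_primeFactors_le (ε / 2) (by positivity)
    refine ⟨C * max κ 0, fun a b c habc => ?_⟩
    have h0 := habc.mul_ne_zero
    have hR := cast_rad_pos a b c
    set R : ℝ := (rad a b c : ℝ)
    have hω : (2 : ℝ) ^ (a * b * c).primeFactors.card ≤ C * R ^ (ε / 2) := by
      have := hCω (a * b * c)
      rwa [← cast_rad_eq_prod] at this
    have hprod : (exponentProduct (a * b * c) : ℝ) ≤ max κ 0 * R ^ (ε / 2) :=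
      (hκ a b c habc).trans (mul_le_mul_of_nonneg_right (le_max_left _ _) (by positivity))
    have hd : ((a * b * c).divisors.card : ℝ)
        ≤ (2 : ℝ) ^ (a * b * c).primeFactors.card * (exponentProduct (a * b * c) : ℝ) := by
      exact_mod_cast card_divisors_le_two_pow_mul_exponentProduct h0
    have hexp : R ^ (ε / 2) * R ^ (ε / 2) = R ^ ε := by
      rw [← Real.rpow_add hR]
      ring_nf
    calc ((a * b * c).divisors.card : ℝ)
          ≤ (2 : ℝ) ^ (a * b * c).primeFactors.card * (exponentProduct (a * b * c) : ℝ) := hd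
      _ ≤ (C * R ^ (ε / 2)) * (max κ 0 * R ^ (ε / 2)) :=
            mul_le_mul hω hprod (by positivity) (by positivity)
      _ = C * max κ 0 * R ^ ε := by rw [← hexp]; ring
  · intro h ε hε
    obtain ⟨K, hK⟩ := h ε hε
    refine ⟨K, fun a b c habc => ?_⟩
    have h1 : (exponentProduct (a * b * c) : ℝ) ≤ ((a * b * c).divisors.card : ℝ) := by
      exact_mod_cast exponentProduct_le_card_divisors habc.mul_ne_zero
    exact h1.trans (hK a b c habc)

/-! ### What the milestone buys: sub-exponential abc for every `ε` (glue C of the route) -/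

/-- `log c ≤ (∏_{p ∣ abc} ν_p(abc)) · log rad(abc)` for an abc triple: `c = ∏_{p ∣ c} p^{ν_p(c)}`,
each `ν_p(c) ≤ ν_p(abc) ≤ ∏_q ν_q(abc) =: E`, so `c ≤ (∏_{p ∣ c} p)^E ≤ rad(abc)^E`. `[folklore]` -/
theorem AbcValuationProduct.log_le_exponentProduct_mul_log_rad {a b c : ℕ} (h : IsABCTriple a b c) :
    Real.log c ≤ exponentProduct (a * b * c) * Real.log (rad a b c : ℝ) := by
  have habc0 : a * b * c ≠ 0 := h.mul_ne_zero
  have hc0 : c ≠ 0 := fun hc => habc0 (by rw [hc, mul_zero])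
  set E := exponentProduct (a * b * c) with hE
  -- every exponent of `c` is at most `E`
  have h1 : ∀ p ∈ c.primeFactors, c.factorization p ≤ E := by
    intro p hp
    have hp' : p ∈ (a * b * c).primeFactors :=
      Nat.primeFactors_mono (dvd_mul_left c (a * b)) habc0 hp
    calc c.factorization p ≤ (a * b * c).factorization p :=
          (Nat.factorization_le_iff_dvd hc0 habc0).2 (dvd_mul_left c (a * b)) p
      _ ≤ E := by
          rw [hE, exponentProduct_def]
          apply Nat.le_of_dvd
          · exact Finset.prod_pos fun q hq =>
              Nat.Prime.factorization_pos_of_dvd (Nat.prime_of_mem_primeFactors hq) habc0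
                (Nat.dvd_of_mem_primeFactors hq)
          · exact Finset.dvd_prod_of_mem _ hp'
  -- hence `c ≤ rad(abc)^E`
  have h2 : ∏ p ∈ c.primeFactors, p ^ c.factorization p = c := by
    rw [← Nat.support_factorization]
    exact Nat.prod_factorization_pow_eq_self hc0
  have h3 : c ≤ rad a b c ^ E := by
    calc c = ∏ p ∈ c.primeFactors, p ^ c.factorization p := h2.symm
      _ ≤ ∏ p ∈ c.primeFactors, p ^ E :=
          Finset.prod_le_prod' fun p hp =>
            Nat.pow_le_pow_right (Nat.prime_of_mem_primeFactors hp).pos (h1 p hp)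
      _ = (∏ p ∈ c.primeFactors, p) ^ E := Finset.prod_pow _ _ _
      _ ≤ (∏ p ∈ (a * b * c).primeFactors, p) ^ E :=
          Nat.pow_le_pow_left
            (Finset.prod_le_prod_of_subset_of_one_le'
              (Nat.primeFactors_mono (dvd_mul_left c (a * b)) habc0)
              fun p hp _ => (Nat.prime_of_mem_primeFactors hp).one_le) _
      _ = rad a b c ^ E := by rw [rad_def, Nat.radical_eq_prod_primeFactors]
  have hc : (0 : ℝ) < c := by exact_mod_cast Nat.pos_of_ne_zero hc0
  calc Real.log c ≤ Real.log ((rad a b c : ℝ) ^ E) :=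
        Real.log_le_log hc (by exact_mod_cast h3)
    _ = E * Real.log (rad a b c : ℝ) := Real.log_pow _ _

/-- The analytic step shared by the glues: if `∏ ν_p(abc) ≤ K · rad^{ε/2}` on an abc triple then
`log c ≤ κ · rad^ε` with `κ = 2 max(K,0)/ε`, by `log c ≤ (∏ ν_p) log rad` and
`log x ≤ (2/ε) x^{ε/2}`. `[folklore]` -/
theorem AbcValuationProduct.log_le_of_exponentProduct_le {ε : ℝ} (hε : 0 < ε) (K : ℝ)
    {a b c : ℕ} (h : IsABCTriple a b c)
    (hK : (exponentProduct (a * b * c) : ℝ) ≤ K * (rad a b c : ℝ) ^ (ε / 2)) :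
    Real.log c ≤ (2 * max K 0 / ε) * (rad a b c : ℝ) ^ ε := by
  have hR : (0 : ℝ) < (rad a b c : ℝ) := cast_rad_pos a b c
  set R : ℝ := (rad a b c : ℝ) with hRdef
  have hR1 : (1 : ℝ) ≤ R := by
    rw [hRdef]; exact_mod_cast (le_trans (by norm_num) h.two_le_rad : 1 ≤ rad a b c)
  have hlogR : 0 ≤ Real.log R := Real.log_nonneg hR1
  have hE : (exponentProduct (a * b * c) : ℝ) ≤ max K 0 * R ^ (ε / 2) :=
    hK.trans (mul_le_mul_of_nonneg_right (le_max_left _ _) (by positivity))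
  have hL : Real.log R ≤ R ^ (ε / 2) / (ε / 2) := Real.log_le_rpow_div hR.le (by positivity)
  have hRR : R ^ (ε / 2) * R ^ (ε / 2) = R ^ ε := by rw [← Real.rpow_add hR]; ring_nf
  calc Real.log c ≤ exponentProduct (a * b * c) * Real.log R :=
        AbcValuationProduct.log_le_exponentProduct_mul_log_rad h
    _ ≤ (max K 0 * R ^ (ε / 2)) * (R ^ (ε / 2) / (ε / 2)) :=
        mul_le_mul hE hL hlogR (by positivity)
    _ = (2 * max K 0 / ε) * (R ^ (ε / 2) * R ^ (ε / 2)) := by field_simp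
    _ = (2 * max K 0 / ε) * R ^ ε := by rw [hRR]

/-- **Glue C.** `AbcValuationProduct` implies sub-exponential abc for every `ε`:
`log c ≤ κ_ε rad(abc)^ε` on all abc triples (apply the milestone at `ε/2` and
`log rad ≤ (2/ε) rad^{ε/2}`). This conclusion is the shared milestone `SubexpABC`, below every
Baker-shape bound (Stewart–Yu: `rad^{1/3} (log rad)^3`). `[folklore]` -/
theorem subexp_of_abcValuationProduct (h : AbcValuationProduct) :
    ∀ ε : ℝ, 0 < ε → ∃ κ : ℝ, ∀ a b c : ℕ, IsABCTriple a b c →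
      Real.log c ≤ κ * (rad a b c : ℝ) ^ ε := by
  intro ε hε
  obtain ⟨K, hK⟩ := h (ε / 2) (by positivity)
  exact ⟨2 * max K 0 / ε, fun a b c ht =>
    AbcValuationProduct.log_le_of_exponentProduct_le hε K ht (hK a b c ht)⟩

/-- The route's glue item `SubexpOfValuationProduct` (`AbcValuationProduct →` sub-exponential
abc for every `ε`) holds. `[folklore]` -/
theorem subexpOfValuationProduct : SubexpOfValuationProduct :=
  subexp_of_abcValuationProduct

end Summit.ABC.ABC.Theorems
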